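import Summits.BirchSwinnertonDyer.BirchSwinnertonDyer.Theorems.ManinLocalTwoThreePinningTwoEightyEight
import Summits.BirchSwinnertonDyer.BirchSwinnertonDyer.Theorems.ManinLocalTwoThreeRootFormsNinetySixBThirtyTwo
import Summits.BirchSwinnertonDyer.BirchSwinnertonDyer.Theorems.ManinLocalTwoThreePinningKernelRows
import Summits.BirchSwinnertonDyer.BirchSwinnertonDyer.Theorems.ManinLocalTwoThreeOddTwistRootFormTransport
import Literature.NumberTheory.EllipticCurves.CuspFormTwist
import Literature.NumberTheory.EllipticCurves.RootNumberTwistProofs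
import HarnessLib

/-!
# Level 288 = 2⁵·3² (BOTH crux domains), the classes `96a ⊗ χ₋₃`, `96b ⊗ χ₋₃`, `32a ⊗ χ₋₃`: `|c| = 1` UNCONDITIONALLY, `2 ∤ c`, `3 ∤ c`,
# by the odd-twist root-form transport at `p = 3`

Cell bsd-f2-manin, route `ManinLocalTwoThree` (cruxes C2 `ManinOddAtFour` stmt-BirchSwinnertonDyer-22967 / C3 `ManinPrimeToThreeAtNine` stmt-…-22968;
`--supports` helper), LEAD p1 gen 27.  an g58's Fricke-staged kernel pins `S₂(Γ₀(288))` (`…PinningTwoEightyEight`, kernel part I, landed by this seat):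
five certificates `rowA…rowE` (the two sign-runs `certP ++ certM`; `(a₅, a₇) = (−4,0), (−2,−4), (−2,4), (2,0), (4,0)`).  The kernel census
(`p1 g27 scripts/census2.py`, `n < 128`): `rowB = 96a ⊗ χ₋₃`, `rowC = 96b ⊗ χ₋₃`, `rowD = 32a ⊗ χ₋₃` (`χ₋₃ = (·/3)`); `rowA/rowE` are twist-minimal
(CM by `ℚ(i)`-type rows, `a₇ = a₁₁ = 0`).  Template LEAD g26 `…ManinConstantTwoHundredC`; roots from `…RootFormsNinetySixBThirtyTwo`:
* §1 rows (depth `128 ≥ 126` = dual support): `f_cases`, selections by `(a₅, a₇)`;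
* §2 headlines by p3's engine at `p = 3` (`96 ∣ 288`, `32 ∣ 288`, `3² ∣ 288`; `96a1/96b1` multiplicative, `32a1` good at `3`):
  `abs_maninConstant_eq_one_twoEightyEight_of_rowBCD` (`|c| = 1` whenever `(a₅(W), a₇(W)) ≠ (∓4, 0)`), `2 ∤ c`, `3 ∤ c` there (C2 AND C3 shapes).
HONEST FRAMING: unconditional (standard axioms); THREE of the five classes of level 288; no root datum, no modularity input, no CDT, no printed Manin fact;
nothing here proves C2/C3, Manin's conjecture or BSD. [cite: CremonaAlgorithms1997, §2.10, Table 1 (N = 32, 96, 288)] [cite: Shimura1971, Prop. 3.64]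
[cite: Stevens1989, Lemma (5.2) p. 96, Lemma (5.4) p. 97] [cite: AgasheRibetStein2006, §§1–2]
-/

set_option autoImplicit false
-- lint-debt: the directory name repeats the summit name (sibling precedent `ManinLocalTwoThreeManinConstantTwoHundredC.lean`)
set_option linter.dupNamespace false

noncomputable section

open Complex
open UpperHalfPlane hiding I
open scoped MatrixGroups ModularForm
open ModularForm CongruenceSubgroup PowerSeries
open Literature.NumberTheory.ModularForms
open Literature.NumberTheory.EllipticCurves Literature.NumberTheory.EllipticCurves.ModularForms

namespace Summit.BirchSwinnertonDyer.BirchSwinnertonDyer.Theorems.ManinLocalTwoThree.LevelTwoEightyEight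

open Summit.BirchSwinnertonDyer.BirchSwinnertonDyer.Theorems.ManinLocalTwoThree
open Summit.BirchSwinnertonDyer.BirchSwinnertonDyer.Theorems
open BracketSturm PinningKernel PinningTwoEightyEight OddTwistRootForm RootFormsOneNinetyTwo RootFormsNinetySixBThirtyTwo

set_option maxHeartbeats 4000000
set_option maxRecDepth 16384

variable {W : WeierstrassCurve ℚ} [W.IsElliptic]

/-! ## §1 The rows -/

/-- The certificate `288a` of an's two sign-runs (`(a₅, a₇) = (-4, 0)`). [folklore] -/
def rowA : List (ℕ × ℤ) × ℤ × List ℤ :=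
  ([(2, 0), (3, 0), (5, -4), (7, 0), (11, 0), (13, -6)], 3, [2, 0, 1, 0, 0, 0, 0, 0, 0, -2, 0, 0, 0, 0, 0, 0, 0, 0, 0, -4, 3, -12, 0, 0, 0, 0, 0, 6, -6, 0, 0, 0, 0])

/-- The certificate `288b` of an's two sign-runs (`(a₅, a₇) = (-2, -4)`) — `96a ⊗ χ₋₃`. [folklore] -/
def rowB : List (ℕ × ℤ) × ℤ × List ℤ :=
  ([(2, 0), (3, 0), (5, -2), (7, -4), (11, -4), (13, -2)], 3, [0, 0, 3, 0, 0, 0, 0, 0, 0, 2, 0, -2, 0, 0, 0, 0, 0, 0, 0, 0, -3, 0, 0, 0, 0, 8, 0, 0, -18, 0, 0, 0, 0])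

/-- The certificate `288c` of an's two sign-runs (`(a₅, a₇) = (-2, 4)`) — `96b ⊗ χ₋₃`. [folklore] -/
def rowC : List (ℕ × ℤ) × ℤ × List ℤ :=
  ([(2, 0), (3, 0), (5, -2), (7, 4), (11, 4), (13, -2)], 3, [0, 0, 3, 0, 0, 0, 0, 0, 0, -2, 0, -2, 4, 0, 0, 0, 0, 0, 0, 0, -3, 0, 0, 0, 0, -8, 0, 0, 18, 0, 0, 0, 0])

/-- The certificate `288d` of an's two sign-runs (`(a₅, a₇) = (2, 0)`) — `32a ⊗ χ₋₃`. [folklore] -/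
def rowD : List (ℕ × ℤ) × ℤ × List ℤ :=
  ([(2, 0), (3, 0), (5, 2), (7, 0), (11, 0), (13, 6)], 3, [2, 0, 1, 0, 0, 0, 0, 0, 0, -2, 0, 0, 0, 0, 0, 0, 0, 0, 0, -4, -3, 12, 0, 0, 0, 0, 0, -6, 6, 0, 0, 0, 0])

/-- The certificate `288e` of an's two sign-runs (`(a₅, a₇) = (4, 0)`). [folklore] -/
def rowE : List (ℕ × ℤ) × ℤ × List ℤ :=
  ([(2, 0), (3, 0), (5, 4), (7, 0), (11, 0), (13, -6)], 1, [2, 0, -1, 0, 0, 0, 0, 0, 0, -2, 0, 0, 0, 0, 0, 0, 0, 0, -12, 4, -3, 12, 0, 0, 0, 0, 0, 6, -6, 0, 0, 0, 0])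

/-- `certP ++ certM` is literally the list of the five rows. [folklore] -/
theorem certs_eq_rows : certP ++ certM = [rowA, rowB, rowC, rowD, rowE] := rfl

/-- `(n/3)·aₙ` of the root of row `288b` to depth `128`. [cite: CremonaAlgorithms1997, Table 1 (N = 288)] -/
def tabTB : List ℤ :=
  [0, 1, 0, 0, 0, -2, 0, -4, 0, 0, 0, -4, 0, -2, 0, 0, 0, 6, 0, -4, 0, 0, 0, 0, 0, -1, 0, 0, 0, -2, 0, 4, 0, 0, 0, 8, 0, -2, 0, 0, 0, -2, 0, 4, 0, 0,
  0, -8, 0, 9, 0, 0, 0, -10, 0, 8, 0, 0, 0, 4, 0, 6, 0, 0, 0, 4, 0, 4, 0, 0, 0, 16, 0, -6, 0, 0, 0, 16, 0, 4, 0, 0, 0, -12, 0, -12, 0, 0, 0, -10, 0,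
  8, 0, 0, 0, 8, 0, -14, 0, 0, 0, 6, 0, -12, 0, 0, 0, 4, 0, 14, 0, 0, 0, -2, 0, 0, 0, 0, 0, -24, 0, 5, 0, 0, 0, 12, 0, -20]

/-- `tabTB[n] = (n/3)·t96a[n]`, `n < 128`. [folklore] -/
theorem hTwB : ∀ n < 128, tabTB.getD n 0 = legendreSym 3 n * t96a.getD n 0 := by
  decide +kernel

/-- **Row identity `288b`.** [folklore] -/
theorem hrowB : ∀ n < 128, rowB.2.1 * tabTB.getD n 0 = ∑ j : Fin 33, rowB.2.2.getD (j : ℕ) 0 * (tabs j).getD n 0 := by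
  decide +kernel

/-- The twisted table as `q`-coefficients in `S₂(Γ₀(288))`. [cite: Shimura1971, Prop. 3.64] -/
theorem tabTB_eq_cuspCoeff [Fact (Nat.Prime 3)] : ∀ n < 128, ((tabTB.getD n 0 : ℤ) : ℂ) =
    cuspCoeffₗ (one_mem_strictPeriods_coe_gamma0 288) n (charTwist 288 (⟨3, rfl⟩ : 96 ∣ 288) (⟨32, rfl⟩ : 3 ^ 2 ∣ 288) (isQuadratic_quadraticChar_ringHomComp 3) F96a) := by
  intro n hn
  have hc : ((tabTB.getD n 0 : ℤ) : ℂ) = ((legendreSym 3 n : ℤ) : ℂ) * ((t96a.getD n 0 : ℤ) : ℂ) := by exact_mod_cast hTwB n hn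
  rw [cuspCoeffₗ_apply, cuspCoeff_charTwist 288 _ _ (isQuadratic_quadraticChar_ringHomComp 3)
    (isPrimitive_quadraticChar_ringHomComp 3 (by norm_num)), quadraticChar_ringHomComp_apply_natCast, ← t96a_eq_cuspCoeff n hn]
  exact hc

/-- `(n/3)·aₙ` of the root of row `288c` to depth `128`. [cite: CremonaAlgorithms1997, Table 1 (N = 288)] -/
def tabTC : List ℤ :=
  [0, 1, 0, 0, 0, -2, 0, 4, 0, 0, 0, 4, 0, -2, 0, 0, 0, 6, 0, 4, 0, 0, 0, 0, 0, -1, 0, 0, 0, -2, 0, -4, 0, 0, 0, -8, 0, -2, 0, 0, 0, -2, 0, -4, 0, 0,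
  0, 8, 0, 9, 0, 0, 0, -10, 0, -8, 0, 0, 0, -4, 0, 6, 0, 0, 0, 4, 0, -4, 0, 0, 0, -16, 0, -6, 0, 0, 0, 16, 0, -4, 0, 0, 0, 12, 0, -12, 0, 0, 0, -10,
  0, -8, 0, 0, 0, -8, 0, -14, 0, 0, 0, 6, 0, 12, 0, 0, 0, -4, 0, 14, 0, 0, 0, -2, 0, 0, 0, 0, 0, 24, 0, 5, 0, 0, 0, 12, 0, 20]

/-- `tabTC[n] = (n/3)·t96b[n]`, `n < 128`. [folklore] -/
theorem hTwC : ∀ n < 128, tabTC.getD n 0 = legendreSym 3 n * t96b.getD n 0 := by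
  decide +kernel

/-- **Row identity `288c`.** [folklore] -/
theorem hrowC : ∀ n < 128, rowC.2.1 * tabTC.getD n 0 = ∑ j : Fin 33, rowC.2.2.getD (j : ℕ) 0 * (tabs j).getD n 0 := by
  decide +kernel

/-- The twisted table as `q`-coefficients in `S₂(Γ₀(288))`. [cite: Shimura1971, Prop. 3.64] -/
theorem tabTC_eq_cuspCoeff [Fact (Nat.Prime 3)] : ∀ n < 128, ((tabTC.getD n 0 : ℤ) : ℂ) =
    cuspCoeffₗ (one_mem_strictPeriods_coe_gamma0 288) n (charTwist 288 (⟨3, rfl⟩ : 96 ∣ 288) (⟨32, rfl⟩ : 3 ^ 2 ∣ 288) (isQuadratic_quadraticChar_ringHomComp 3) F96b) := by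
  intro n hn
  have hc : ((tabTC.getD n 0 : ℤ) : ℂ) = ((legendreSym 3 n : ℤ) : ℂ) * ((t96b.getD n 0 : ℤ) : ℂ) := by exact_mod_cast hTwC n hn
  rw [cuspCoeffₗ_apply, cuspCoeff_charTwist 288 _ _ (isQuadratic_quadraticChar_ringHomComp 3)
    (isPrimitive_quadraticChar_ringHomComp 3 (by norm_num)), quadraticChar_ringHomComp_apply_natCast, ← t96b_eq_cuspCoeff n hn]
  exact hc

/-- `(n/3)·aₙ` of the root of row `288d` to depth `128`. [cite: CremonaAlgorithms1997, Table 1 (N = 288)] -/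
def tabTD : List ℤ :=
  [0, 1, 0, 0, 0, 2, 0, 0, 0, 0, 0, 0, 0, 6, 0, 0, 0, -2, 0, 0, 0, 0, 0, 0, 0, -1, 0, 0, 0, 10, 0, 0, 0, 0, 0, 0, 0, -2, 0, 0, 0, -10, 0, 0, 0, 0, 0,
  0, 0, -7, 0, 0, 0, -14, 0, 0, 0, 0, 0, 0, 0, -10, 0, 0, 0, 12, 0, 0, 0, 0, 0, 0, 0, -6, 0, 0, 0, 0, 0, 0, 0, 0, 0, 0, 0, -4, 0, 0, 0, -10, 0, 0, 0,
  0, 0, 0, 0, 18, 0, 0, 0, 2, 0, 0, 0, 0, 0, 0, 0, 6, 0, 0, 0, 14, 0, 0, 0, 0, 0, 0, 0, -11, 0, 0, 0, -12, 0, 0]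

/-- `tabTD[n] = (n/3)·t32[n]`, `n < 128`. [folklore] -/
theorem hTwD : ∀ n < 128, tabTD.getD n 0 = legendreSym 3 n * t32.getD n 0 := by
  decide +kernel

/-- **Row identity `288d`.** [folklore] -/
theorem hrowD : ∀ n < 128, rowD.2.1 * tabTD.getD n 0 = ∑ j : Fin 33, rowD.2.2.getD (j : ℕ) 0 * (tabs j).getD n 0 := by
  decide +kernel

/-- The twisted table as `q`-coefficients in `S₂(Γ₀(288))`. [cite: Shimura1971, Prop. 3.64] -/
theorem tabTD_eq_cuspCoeff [Fact (Nat.Prime 3)] : ∀ n < 128, ((tabTD.getD n 0 : ℤ) : ℂ) =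
    cuspCoeffₗ (one_mem_strictPeriods_coe_gamma0 288) n (charTwist 288 (⟨9, rfl⟩ : 32 ∣ 288) (⟨32, rfl⟩ : 3 ^ 2 ∣ 288) (isQuadratic_quadraticChar_ringHomComp 3) cuspFormEtaProductThirtyTwo) := by
  intro n hn
  have hc : ((tabTD.getD n 0 : ℤ) : ℂ) = ((legendreSym 3 n : ℤ) : ℂ) * ((t32.getD n 0 : ℤ) : ℂ) := by exact_mod_cast hTwD n hn
  rw [cuspCoeffₗ_apply, cuspCoeff_charTwist 288 _ _ (isQuadratic_quadraticChar_ringHomComp 3)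
    (isPrimitive_quadraticChar_ringHomComp 3 (by norm_num)), quadraticChar_ringHomComp_apply_natCast, ← t32_eq_cuspCoeff n hn]
  exact hc

/-- **LEVEL 288: THE ROWS.**  For every `X₀(288)`-datum `D` of an elliptic `W/ℚ`: the sieve truth row is one of the five certificates; on rows
`B`, `C`, `D` the newform is the EXPLICIT twist `φ₉₆ₐ ⊗ χ₋₃`, `φ₉₆ᵦ ⊗ χ₋₃`, `φ₃₂ ⊗ χ₋₃`. [cite: CremonaAlgorithms1997, §2.10, Table 1 (N = 288)] [cite: Shimura1971, Prop. 3.64] -/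
theorem f_cases [Fact (Nat.Prime 3)] (D : ModularParametrizationData W 288) :
    truth W [2, 3, 5, 7, 11, 13] = rowA.1 ∨
    (truth W [2, 3, 5, 7, 11, 13] = rowB.1 ∧
      D.f = charTwist 288 (⟨3, rfl⟩ : 96 ∣ 288) (⟨32, rfl⟩ : 3 ^ 2 ∣ 288) (isQuadratic_quadraticChar_ringHomComp 3) F96a) ∨
    (truth W [2, 3, 5, 7, 11, 13] = rowC.1 ∧
      D.f = charTwist 288 (⟨3, rfl⟩ : 96 ∣ 288) (⟨32, rfl⟩ : 3 ^ 2 ∣ 288) (isQuadratic_quadraticChar_ringHomComp 3) F96b) ∨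
    (truth W [2, 3, 5, 7, 11, 13] = rowD.1 ∧
      D.f = charTwist 288 (⟨9, rfl⟩ : 32 ∣ 288) (⟨32, rfl⟩ : 3 ^ 2 ∣ 288) (isQuadratic_quadraticChar_ringHomComp 3) cuspFormEtaProductThirtyTwo) ∨
    truth W [2, 3, 5, 7, 11, 13] = rowE.1 := by
  haveI : FiniteDimensional ℂ (CuspForm (Gamma0 288) 2) := finiteDimensional_cuspForm_gamma0 288 2
  have hlen : ∀ i : Fin 33, (duals i).length ≤ 128 := by decide +kernel
  obtain ⟨S, C, hCS, hC, c, hc, htruth, hpinS, -⟩ := pinning_cusp D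
  have ht := tables_of_etaCertsSparse 288 128 (fun i : Fin 33 ↦ expFn (Ls[(i : ℕ)]).1) (fun i ↦ shifts i) tabs C hC hshift hcert
  have htS : ∀ i, ∀ n < 128, (((tabs i).getD n 0 : ℤ) : ℂ) = cuspCoeffₗ (one_mem_strictPeriods_coe_gamma0 288) n (S i) :=
    fun i n hn ↦ by rw [cuspCoeffₗ_apply, ← modCoefₗ_modularForm (S i) n, hCS]; exact ht i n hn
  rw [certs_eq_rows] at hc
  simp only [List.mem_cons, List.mem_nil_iff, or_false] at hc
  rcases hc with rfl | rfl | rfl | rfl | rfl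
  · exact Or.inl htruth
  · exact Or.inr (Or.inl ⟨htruth, eq_of_smul_eq_sum_of_row S tabs duals 288 htS hlen hdual (by norm_num) finrank_cuspForm_two _
      tabTB tabTB_eq_cuspCoeff rowB.2.1 (by decide) rowB.2.2 hpinS hrowB⟩)
  · exact Or.inr (Or.inr (Or.inl ⟨htruth, eq_of_smul_eq_sum_of_row S tabs duals 288 htS hlen hdual (by norm_num) finrank_cuspForm_two _
      tabTC tabTC_eq_cuspCoeff rowC.2.1 (by decide) rowC.2.2 hpinS hrowC⟩))
  · exact Or.inr (Or.inr (Or.inr (Or.inl ⟨htruth, eq_of_smul_eq_sum_of_row S tabs duals 288 htS hlen hdual (by norm_num) finrank_cuspForm_two _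
      tabTD tabTD_eq_cuspCoeff rowD.2.1 (by decide) rowD.2.2 hpinS hrowD⟩)))
  · exact Or.inr (Or.inr (Or.inr (Or.inr (htruth))))

omit [W.IsElliptic] in
/-- The `a₅`/`a₇` entries of the truth row. [folklore] -/
theorem key (row : List (ℕ × ℤ) × ℤ × List ℤ) (h : truth W [2, 3, 5, 7, 11, 13] = row.1) :
    W.LFunction 5 = (row.1.getD 2 (0, 0)).2 ∧ W.LFunction 7 = (row.1.getD 3 (0, 0)).2 :=
  ⟨by simpa [truth] using congrArg (fun l : List (ℕ × ℤ) ↦ (l.getD 2 (0, 0)).2) h,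
   by simpa [truth] using congrArg (fun l : List (ℕ × ℤ) ↦ (l.getD 3 (0, 0)).2) h⟩

/-- **Row `288b` selected by `a₅(W) = −2`, `a₇(W) = −4`**: `D.f = φ₉₆ₐ ⊗ χ₋₃`. [cite: CremonaAlgorithms1997, Table 1 (N = 288)] -/
theorem f_eq_charTwist_F96a_of_lFunction [Fact (Nat.Prime 3)] (D : ModularParametrizationData W 288) (h5 : W.LFunction 5 = -2) (h7 : W.LFunction 7 = -4) :
    D.f = charTwist 288 (⟨3, rfl⟩ : 96 ∣ 288) (⟨32, rfl⟩ : 3 ^ 2 ∣ 288) (isQuadratic_quadraticChar_ringHomComp 3) F96a := by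
  rcases f_cases D with h | ⟨h, hf⟩ | ⟨h, hf⟩ | ⟨h, hf⟩ | h
  · have h' := (key rowA h).1; rw [h5] at h'; simp [rowA] at h'
  · exact hf
  · have h' := (key rowC h).2; rw [h7] at h'; simp [rowC] at h'
  · have h' := (key rowD h).1; rw [h5] at h'; simp [rowD] at h'
  · have h' := (key rowE h).1; rw [h5] at h'; simp [rowE] at h'

/-- **Row `288c` selected by `a₅(W) = −2`, `a₇(W) = 4`**: `D.f = φ₉₆ᵦ ⊗ χ₋₃`. [cite: CremonaAlgorithms1997, Table 1 (N = 288)] -/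
theorem f_eq_charTwist_F96b_of_lFunction [Fact (Nat.Prime 3)] (D : ModularParametrizationData W 288) (h5 : W.LFunction 5 = -2) (h7 : W.LFunction 7 = 4) :
    D.f = charTwist 288 (⟨3, rfl⟩ : 96 ∣ 288) (⟨32, rfl⟩ : 3 ^ 2 ∣ 288) (isQuadratic_quadraticChar_ringHomComp 3) F96b := by
  rcases f_cases D with h | ⟨h, hf⟩ | ⟨h, hf⟩ | ⟨h, hf⟩ | h
  · have h' := (key rowA h).1; rw [h5] at h'; simp [rowA] at h'
  · have h' := (key rowB h).2; rw [h7] at h'; simp [rowB] at h'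
  · exact hf
  · have h' := (key rowD h).1; rw [h5] at h'; simp [rowD] at h'
  · have h' := (key rowE h).1; rw [h5] at h'; simp [rowE] at h'

/-- **Row `288d` selected by `a₅(W) = 2`**: `D.f = φ₃₂ ⊗ χ₋₃`. [cite: CremonaAlgorithms1997, Table 1 (N = 288)] -/
theorem f_eq_charTwist_phi32_of_lFunction [Fact (Nat.Prime 3)] (D : ModularParametrizationData W 288) (h5 : W.LFunction 5 = 2) :
    D.f = charTwist 288 (⟨9, rfl⟩ : 32 ∣ 288) (⟨32, rfl⟩ : 3 ^ 2 ∣ 288) (isQuadratic_quadraticChar_ringHomComp 3) cuspFormEtaProductThirtyTwo := by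
  rcases f_cases D with h | ⟨h, hf⟩ | ⟨h, hf⟩ | ⟨h, hf⟩ | h
  · have h' := (key rowA h).1; rw [h5] at h'; simp [rowA] at h'
  · have h' := (key rowB h).1; rw [h5] at h'; simp [rowB] at h'
  · have h' := (key rowC h).1; rw [h5] at h'; simp [rowC] at h'
  · exact hf
  · have h' := (key rowE h).1; rw [h5] at h'; simp [rowE] at h'

/-! ## §2 The headlines -/

/-- **`|c| = 1` ON THE CLASS `96a ⊗ χ₋₃` OF LEVEL 288, UNCONDITIONALLY** (`a₅ = −2`, `a₇ = −4`). [cite: Stevens1989, Lemma (5.2) p. 96, Lemma (5.4) p. 97]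
[cite: AgasheRibetStein2006, §§1–2] -/
theorem abs_maninConstant_eq_one_twoEightyEight_rowB (W : WeierstrassCurve ℚ) [W.IsElliptic] [W.IsGloballyMinimal]
    (D : ModularParametrizationData W 288) (h5 : W.LFunction 5 = -2) (h7 : W.LFunction 7 = -4)
    (hopt : ∀ z ∈ D.L.lattice, ∃ w ∈ periodLattice D.f, z = D.c * w) : |D.maninConstant| = 1 := by
  haveI h3 : Fact (Nat.Prime 3) := ⟨by norm_num⟩
  obtain ⟨L₀, hL₀, hle⟩ := exists_neron_squeeze_F96a
  haveI := NeronSqueezeNinetySixA.isElliptic_ninetySixA1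
  haveI := NeronSqueezeNinetySixA.isGloballyMinimal_ninetySixA1
  exact abs_maninConstant_eq_one_of_rootForm_charTwist_eq (p := 3) (by norm_num) (isQuadratic_quadraticChar_ringHomComp 3)
    (isPrimitive_quadraticChar_ringHomComp 3 (by norm_num)) F96a (⟨0, 1, 0, -2, 0⟩ : WeierstrassCurve ℚ) L₀ hL₀ hle
    (Or.inr hasMultiplicativeReductionAtPrime_three_ninetySixA1) W D _ _ (f_eq_charTwist_F96a_of_lFunction D h5 h7) hopt

/-- **`|c| = 1` ON THE CLASS `96b ⊗ χ₋₃` OF LEVEL 288, UNCONDITIONALLY** (`a₅ = −2`, `a₇ = 4`). [cite: Stevens1989, Lemma (5.2) p. 96, Lemma (5.4) p. 97]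
[cite: AgasheRibetStein2006, §§1–2] -/
theorem abs_maninConstant_eq_one_twoEightyEight_rowC (W : WeierstrassCurve ℚ) [W.IsElliptic] [W.IsGloballyMinimal]
    (D : ModularParametrizationData W 288) (h5 : W.LFunction 5 = -2) (h7 : W.LFunction 7 = 4)
    (hopt : ∀ z ∈ D.L.lattice, ∃ w ∈ periodLattice D.f, z = D.c * w) : |D.maninConstant| = 1 := by
  haveI h3 : Fact (Nat.Prime 3) := ⟨by norm_num⟩
  obtain ⟨L₀, hL₀, hle⟩ := exists_neron_squeeze_F96b
  haveI := NeronSqueezeNinetySixB.isElliptic_ninetySixB1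
  haveI := NeronSqueezeNinetySixB.isGloballyMinimal_ninetySixB1
  exact abs_maninConstant_eq_one_of_rootForm_charTwist_eq (p := 3) (by norm_num) (isQuadratic_quadraticChar_ringHomComp 3)
    (isPrimitive_quadraticChar_ringHomComp 3 (by norm_num)) F96b (⟨0, -1, 0, -2, 0⟩ : WeierstrassCurve ℚ) L₀ hL₀ hle
    (Or.inr hasMultiplicativeReductionAtPrime_three_ninetySixB1) W D _ _ (f_eq_charTwist_F96b_of_lFunction D h5 h7) hopt

/-- **`|c| = 1` ON THE CLASS `32a ⊗ χ₋₃` OF LEVEL 288, UNCONDITIONALLY** (`a₅ = 2`). [cite: Stevens1989, Lemma (5.2) p. 96, Lemma (5.4) p. 97]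
[cite: AgasheRibetStein2006, §§1–2] -/
theorem abs_maninConstant_eq_one_twoEightyEight_rowD (W : WeierstrassCurve ℚ) [W.IsElliptic] [W.IsGloballyMinimal]
    (D : ModularParametrizationData W 288) (h5 : W.LFunction 5 = 2)
    (hopt : ∀ z ∈ D.L.lattice, ∃ w ∈ periodLattice D.f, z = D.c * w) : |D.maninConstant| = 1 := by
  haveI h3 : Fact (Nat.Prime 3) := ⟨by norm_num⟩
  obtain ⟨L₀, hL₀, hle⟩ := exists_neron_squeeze_phi32
  haveI := isElliptic_caseIII_example
  haveI := isGloballyMinimal_thirtyTwoA1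
  exact abs_maninConstant_eq_one_of_rootForm_charTwist_eq (p := 3) (by norm_num) (isQuadratic_quadraticChar_ringHomComp 3)
    (isPrimitive_quadraticChar_ringHomComp 3 (by norm_num)) cuspFormEtaProductThirtyTwo (⟨0, 0, 0, 4, 0⟩ : WeierstrassCurve ℚ) L₀ hL₀ hle
    (Or.inl hasGoodReductionAtPrime_three_thirtyTwoA1) W D _ _ (f_eq_charTwist_phi32_of_lFunction D h5) hopt

/-- **`|c| = 1` on the three transported classes of level 288** (`(a₅, a₇) ∉ {(−4,0), (4,0)}`, i.e. `a₅ = 2`, or `a₅ = −2` with `a₇ = ∓4`).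
[cite: AgasheRibetStein2006, §§1–2] -/
theorem abs_maninConstant_eq_one_twoEightyEight_of_rowBCD (W : WeierstrassCurve ℚ) [W.IsElliptic] [W.IsGloballyMinimal]
    (D : ModularParametrizationData W 288) (h : (W.LFunction 5 = -2 ∧ (W.LFunction 7 = -4 ∨ W.LFunction 7 = 4)) ∨ W.LFunction 5 = 2)
    (hopt : ∀ z ∈ D.L.lattice, ∃ w ∈ periodLattice D.f, z = D.c * w) : |D.maninConstant| = 1 := by
  rcases h with ⟨h5, h7 | h7⟩ | h5
  · exact abs_maninConstant_eq_one_twoEightyEight_rowB W D h5 h7 hopt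
  · exact abs_maninConstant_eq_one_twoEightyEight_rowC W D h5 h7 hopt
  · exact abs_maninConstant_eq_one_twoEightyEight_rowD W D h5 hopt

/-- **No integer `q` with `|q| ≠ 1` — in particular neither `2` nor `3` — divides `c` there.** [folklore] -/
theorem not_dvd_maninConstant_twoEightyEight_of_rowBCD (W : WeierstrassCurve ℚ) [W.IsElliptic] [W.IsGloballyMinimal]
    (D : ModularParametrizationData W 288) (h : (W.LFunction 5 = -2 ∧ (W.LFunction 7 = -4 ∨ W.LFunction 7 = 4)) ∨ W.LFunction 5 = 2)
    (hopt : ∀ z ∈ D.L.lattice, ∃ w ∈ periodLattice D.f, z = D.c * w) {q : ℤ} (hq : q.natAbs ≠ 1) : ¬ q ∣ D.maninConstant := by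
  intro hd
  have h1 := abs_maninConstant_eq_one_twoEightyEight_of_rowBCD W D h hopt
  have hn : D.maninConstant.natAbs = 1 := by
    rw [Int.abs_eq_natAbs] at h1
    exact_mod_cast h1
  have h2 : q.natAbs ∣ 1 := hn ▸ Int.natAbs_dvd_natAbs.mpr hd
  exact hq (Nat.dvd_one.mp h2)

/-- **`2 ∤ c` there** — the body of C2 `ManinOddAtFour` at `N = 288` (`2² ∣ 288`) on the three classes. [cite: AgasheRibetStein2006, §§1–2] -/
theorem not_two_dvd_maninConstant_twoEightyEight_of_rowBCD (W : WeierstrassCurve ℚ) [W.IsElliptic] [W.IsGloballyMinimal]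
    (D : ModularParametrizationData W 288) (h : (W.LFunction 5 = -2 ∧ (W.LFunction 7 = -4 ∨ W.LFunction 7 = 4)) ∨ W.LFunction 5 = 2)
    (hopt : ∀ z ∈ D.L.lattice, ∃ w ∈ periodLattice D.f, z = D.c * w) : ¬ (2 : ℤ) ∣ D.maninConstant :=
  not_dvd_maninConstant_twoEightyEight_of_rowBCD W D h hopt (by decide)

/-- **`3 ∤ c` there** — the body of C3 `ManinPrimeToThreeAtNine` at `N = 288` (`3² ∣ 288`) on the three classes. [cite: AgasheRibetStein2006, §§1–2] -/
theorem not_three_dvd_maninConstant_twoEightyEight_of_rowBCD (W : WeierstrassCurve ℚ) [W.IsElliptic] [W.IsGloballyMinimal]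
    (D : ModularParametrizationData W 288) (h : (W.LFunction 5 = -2 ∧ (W.LFunction 7 = -4 ∨ W.LFunction 7 = 4)) ∨ W.LFunction 5 = 2)
    (hopt : ∀ z ∈ D.L.lattice, ∃ w ∈ periodLattice D.f, z = D.c * w) : ¬ (3 : ℤ) ∣ D.maninConstant :=
  not_dvd_maninConstant_twoEightyEight_of_rowBCD W D h hopt (by decide)

end Summit.BirchSwinnertonDyer.BirchSwinnertonDyer.Theorems.ManinLocalTwoThree.LevelTwoEightyEight

end
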